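import Literature.NumberTheory.Automorphic.IwahoriGL
import Literature.NumberTheory.Automorphic.IwasawaDecompositionGL
import HarnessLib

/-!
# Triangular factorisation in the first congruence subgroup of `GL_n` and
`ϖ^a K₁ ϖ^b ⊆ K₁ ϖ^{a+b} K₁`

Topic `NumberTheory/Automorphic`; theorems only (no definition, no named fact). Setting: a field
`F` with a `ValuativeRel` (valuation ring `𝒪 = 𝒪[F]`, maximal ideal `𝓂`), `K = GL_n(𝒪) = glInt n F`
and the **first congruence subgroup** `K₁ = 1 + 𝓂 M_n(𝒪)`, which in the tree is
`proUnipotentGL n F c` for a *constant* block labelling `c` (`IwahoriGL`: the pro-unipotent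
radical of the parahoric of `c`; for `c` constant the parahoric is `K` and its pro-unipotent
radical is the kernel of reduction mod `𝓂`). Throughout `hc : ∀ i j, c i = c j` records that `c` is
constant.

* `mem_proUnipotentGL_iff_of_const`: `g ∈ K₁ ↔ g ∈ K ∧ g ≡ 1 (mod 𝓂)` entrywise.
* `exists_upper_mul_lower_of_mem_proUnipotentGL` (**triangular factorisation**): every `k ∈ K₁`
  is `k = B L` with `B ∈ K₁` upper triangular and `L ∈ K₁` lower triangular — Gaussian
  elimination by integral column operations exactly as in the tree's Iwasawa decomposition
  (`IwasawaDecompositionGL.exists_mul_glInt_isRowTriangularFrom`, `rowClearGL`), except that for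
  `k ≡ 1 (mod 𝓂)` the diagonal pivots are units and the multipliers lie in `𝓂`, so that every
  elementary factor stays in `K₁` (this is the Iwahori factorisation of `K₁` with respect to the
  Borel pair, Casselman (1995), Prop. 1.4.4, in the weak form "upper × lower" which is all that is
  used below).
* `zpowDiagGL_conj_mem_proUnipotentGL`: conjugating `x ∈ K₁` by `ϖ^e = diag(ϖ^{e_i})` keeps it in
  `K₁` as soon as `e_j ≤ e_i` wherever `x_{ij} ≠ 0` (the entry `x_{ij}` is multiplied by
  `ϖ^{e_i - e_j} ∈ 𝒪`).
* `exists_zpowDiagGL_mul_mul_zpowDiagGL_eq` (**the expansion property of dominant torus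
  elements**): for antitone (`a_1 ≥ ⋯ ≥ a_n`) exponent vectors `a, b ∈ ℤⁿ` and `k ∈ K₁`,
  `ϖ^a k ϖ^b ∈ K₁ (ϖ^a ϖ^b) K₁`; i.e. `K₁ ϖ^a K₁ · K₁ ϖ^b K₁ = K₁ ϖ^{a+b} K₁`. This is the
  set-theoretic input for the multiplicativity `[K₁ ϖ^a K₁][K₁ ϖ^b K₁] = N • [K₁ ϖ^{a+b} K₁]` of
  Hecke operators along the dominant cone (Casselman (1995), Lemma 4.1.5; Bernstein's
  presentation of the Iwahori–Hecke algebra, Lusztig (1989), for the Iwahori subgroup), used in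
  `SphericalCoefficientGrowth` to bound spherical matrix coefficients.

## References

* W. Casselman, *Introduction to the theory of admissible representations of 𝔭-adic reductive
  groups* (1995 notes), Prop. 1.4.4 (Iwahori factorisation of congruence subgroups) and
  Lemma 4.1.5 (multiplicativity on the dominant cone).
* D. Bump, *Automorphic Forms and Representations* (1997), Prop. 4.5.2 (the elimination used here)
  [Bump1997].
-/

noncomputable section

open ValuativeRel Matrix

namespace Literature.NumberTheory.Automorphic

variable {F : Type*} [Field F] [ValuativeRel F] {n : ℕ} {α : Type*} [LinearOrder α]
  {c : Fin n → α}

/-! ### The first congruence subgroup `K₁ = 1 + 𝓂 M_n(𝒪)` -/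

/-- **Membership in `K₁`** for a constant labelling `c`: `g ∈ proUnipotentGL n F c` iff
`g ∈ GL_n(𝒪)` and `g ≡ 1 (mod 𝓂)` entrywise, i.e. `|g_{ij} - δ_{ij}| < 1`. [folklore] -/
theorem mem_proUnipotentGL_iff_of_const (hc : ∀ i j, c i = c j) (g : GL (Fin n) F) :
    g ∈ proUnipotentGL n F c ↔ g ∈ glInt n F ∧
      ∀ i j, valuation F ((g : Matrix (Fin n) (Fin n) F) i j - if i = j then 1 else 0) < 1 := by
  rw [mem_proUnipotentGL_iff]
  constructor
  · rintro ⟨hg, -, h⟩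
    exact ⟨hg, fun i j => h i j (hc i j)⟩
  · rintro ⟨hg, h⟩
    refine ⟨hg, fun i j hij => ?_, fun i j _ => h i j⟩
    rw [hc i j] at hij
    exact absurd hij (lt_irrefl _)

/-- The diagonal entries of an element of `K₁` have valuation `1` (`|1 + x| = 1` for `|x| < 1`).
[folklore] -/
theorem valuation_apply_self_eq_one_of_mem_proUnipotentGL (hc : ∀ i j, c i = c j)
    {g : GL (Fin n) F} (hg : g ∈ proUnipotentGL n F c) (i : Fin n) :
    valuation F ((g : Matrix (Fin n) (Fin n) F) i i) = 1 := by
  have h := ((mem_proUnipotentGL_iff_of_const hc g).1 hg).2 i i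
  rw [if_pos rfl] at h
  have e : (g : Matrix (Fin n) (Fin n) F) i i = 1 + ((g : Matrix (Fin n) (Fin n) F) i i - 1) := by
    ring
  rw [e]
  exact Valuation.map_one_add_of_lt _ h

/-- The off-diagonal entries of an element of `K₁` have valuation `< 1`. [folklore] -/
theorem valuation_apply_lt_one_of_mem_proUnipotentGL (hc : ∀ i j, c i = c j)
    {g : GL (Fin n) F} (hg : g ∈ proUnipotentGL n F c) {i j : Fin n} (hij : i ≠ j) :
    valuation F ((g : Matrix (Fin n) (Fin n) F) i j) < 1 := by
  have h := ((mem_proUnipotentGL_iff_of_const hc g).1 hg).2 i j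
  rwa [if_neg hij, sub_zero] at h

/-! ### Triangular factorisation `K₁ = (K₁ ∩ B) (K₁ ∩ N̄)` -/

/-- **Elimination step inside `K₁`.** If `g ∈ K₁` has upper triangular rows `> i₀`, then for the
lower unitriangular `k = rowClearGL i₀ (g_{i₀ b} / g_{i₀ i₀})_b ∈ K₁` (the pivot `g_{i₀ i₀}` is a
unit and the multipliers lie in `𝓂`) the rows `≥ i₀` of `g k` are upper triangular.
[folklore] -/
theorem exists_mul_lower_isRowTriangularFrom_of_mem_proUnipotentGL (hc : ∀ i j, c i = c j)
    {g : GL (Fin n) F} (hg : g ∈ proUnipotentGL n F c) (i₀ : Fin n)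
    (htri : IsRowTriangularFrom (g : Matrix (Fin n) (Fin n) F) (i₀ + 1)) :
    ∃ k ∈ proUnipotentGL n F c,
      (k : Matrix (Fin n) (Fin n) F).BlockTriangular OrderDual.toDual ∧
      IsRowTriangularFrom ((g * k : GL (Fin n) F) : Matrix (Fin n) (Fin n) F) i₀ := by
  classical
  have hvp : valuation F ((g : Matrix (Fin n) (Fin n) F) i₀ i₀) = 1 :=
    valuation_apply_self_eq_one_of_mem_proUnipotentGL hc hg i₀
  have hp0 : (g : Matrix (Fin n) (Fin n) F) i₀ i₀ ≠ 0 := by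
    intro h0
    rw [h0, map_zero] at hvp
    exact zero_ne_one hvp
  set c' : Fin n → F := fun b =>
    (g : Matrix (Fin n) (Fin n) F) i₀ b / (g : Matrix (Fin n) (Fin n) F) i₀ i₀ with hc'
  have hc'v : ∀ b, b ≠ i₀ → valuation F (c' b) < 1 := by
    intro b hb
    change valuation F ((g : Matrix (Fin n) (Fin n) F) i₀ b /
      (g : Matrix (Fin n) (Fin n) F) i₀ i₀) < 1
    rw [map_div₀, hvp, div_one]
    exact valuation_apply_lt_one_of_mem_proUnipotentGL hc hg (Ne.symm hb)
  have hc'mem : ∀ b, b < i₀ → c' b ∈ 𝒪[F] := fun b hb =>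
    (Valuation.mem_integer_iff _ _).2 (hc'v b hb.ne).le
  refine ⟨rowClearGL i₀ c', ?_, ?_, ?_⟩
  · -- membership in `K₁`
    rw [mem_proUnipotentGL_iff_of_const hc]
    refine ⟨rowClearGL_mem_glInt i₀ hc'mem, fun a b => ?_⟩
    rw [coe_rowClearGL, rowClearMatrix_apply, add_sub_cancel_left]
    split_ifs with h
    · rw [Valuation.map_neg]
      exact hc'v b h.2.ne
    · rw [map_zero]
      exact zero_lt_one
  · -- lower triangularity
    rw [coe_rowClearGL]
    exact blockTriangular_toDual_rowClearMatrix i₀ c'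
  · -- the rows `≥ i₀` of `g k` are upper triangular
    intro i j hi hj
    rw [Units.val_mul, coe_rowClearGL, mul_rowClearMatrix_apply]
    rcases (Nat.le_iff_lt_or_eq.mp hi) with hlt | heq
    · have hlt' : i₀ < i := Fin.lt_def.mpr hlt
      rw [htri i j (Nat.succ_le_of_lt hlt) hj, htri i i₀ (Nat.succ_le_of_lt hlt) hlt']
      simp
    · have hi0 : i₀ = i := Fin.ext heq
      subst hi0
      rw [if_pos hj, hc']
      dsimp only
      rw [div_mul_cancel₀ _ hp0, sub_self]

/-- Induction on the number of rows: if `g ∈ K₁` has upper triangular rows `≥ m`, then `g k` is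
upper triangular for some lower triangular `k ∈ K₁`. [folklore] -/
theorem exists_mul_lower_blockTriangular_of_mem_proUnipotentGL (hc : ∀ i j, c i = c j) (m : ℕ) :
    ∀ g ∈ proUnipotentGL n F c, IsRowTriangularFrom (g : Matrix (Fin n) (Fin n) F) m →
      ∃ k ∈ proUnipotentGL n F c,
        (k : Matrix (Fin n) (Fin n) F).BlockTriangular OrderDual.toDual ∧
        ((g * k : GL (Fin n) F) : Matrix (Fin n) (Fin n) F).BlockTriangular id := by
  induction m with
  | zero =>
    intro g _ hg
    refine ⟨1, Subgroup.one_mem _, ?_, by rw [mul_one]; exact isRowTriangularFrom_zero_iff.mp hg⟩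
    rw [Units.val_one, ← Matrix.diagonal_one]
    exact Matrix.blockTriangular_diagonal _
  | succ m ih =>
    intro g hgK hg
    by_cases hm : m < n
    · obtain ⟨k, hk, hkl, hgk⟩ :=
        exists_mul_lower_isRowTriangularFrom_of_mem_proUnipotentGL hc hgK ⟨m, hm⟩ hg
      obtain ⟨k', hk', hk'l, h'⟩ := ih (g * k) (Subgroup.mul_mem _ hgK hk) hgk
      refine ⟨k * k', Subgroup.mul_mem _ hk hk', ?_, by rw [← mul_assoc]; exact h'⟩
      rw [Units.val_mul]
      exact hkl.mul hk'l
    · exact ih g hgK (isRowTriangularFrom_of_le (not_lt.mp hm))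

/-- **Triangular factorisation in `K₁`.** Every `k ∈ K₁ = 1 + 𝓂 M_n(𝒪)` factors as `k = B L`
with `B ∈ K₁` upper triangular and `L ∈ K₁` lower triangular (the "upper × lower" form of the
Iwahori factorisation of the first congruence subgroup; Casselman (1995), Prop. 1.4.4).
[folklore] -/
theorem exists_upper_mul_lower_of_mem_proUnipotentGL (hc : ∀ i j, c i = c j) {k : GL (Fin n) F}
    (hk : k ∈ proUnipotentGL n F c) :
    ∃ B ∈ proUnipotentGL n F c, ∃ L ∈ proUnipotentGL n F c,
      (B : Matrix (Fin n) (Fin n) F).BlockTriangular id ∧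
      (L : Matrix (Fin n) (Fin n) F).BlockTriangular OrderDual.toDual ∧ k = B * L := by
  obtain ⟨k', hk', hk'l, hB⟩ := exists_mul_lower_blockTriangular_of_mem_proUnipotentGL hc n k hk
    (isRowTriangularFrom_of_le le_rfl)
  refine ⟨k * k', Subgroup.mul_mem _ hk hk', k'⁻¹, Subgroup.inv_mem _ hk', hB, ?_,
    (mul_inv_cancel_right k k').symm⟩
  rw [Matrix.coe_units_inv]
  letI : Invertible (k' : Matrix (Fin n) (Fin n) F) := k'.invertible
  exact Matrix.blockTriangular_inv_of_blockTriangular hk'l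

/-! ### Conjugation by dominant torus elements -/

omit [ValuativeRel F] in
/-- Entries of `ϖ^e x ϖ^{-e}`: `x_{ij} ϖ^{e_i - e_j}`. [folklore] -/
theorem zpowDiagGL_mul_mul_zpowDiagGL_neg_apply {ϖ : F} (hϖ : ϖ ≠ 0) (e : Fin n → ℤ)
    (x : GL (Fin n) F) (i j : Fin n) :
    ((zpowDiagGL hϖ e * x * zpowDiagGL hϖ (-e) : GL (Fin n) F) : Matrix (Fin n) (Fin n) F) i j =
      (x : Matrix (Fin n) (Fin n) F) i j * ϖ ^ (e i - e j) := by
  rw [Units.val_mul, Units.val_mul, coe_zpowDiagGL, coe_zpowDiagGL, Matrix.mul_diagonal,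
    Matrix.diagonal_mul, Pi.neg_apply, zpow_sub₀ hϖ, _root_.zpow_neg]
  ring

/-- **Conjugation by `ϖ^e` preserves `K₁` along the non-negative directions**: if `x ∈ K₁` and
`e_j ≤ e_i` whenever `x_{ij} ≠ 0` (so that `x_{ij}` gets multiplied by `ϖ^{e_i - e_j} ∈ 𝒪`), then
`ϖ^e x ϖ^{-e} ∈ K₁` (here `|ϖ| ≤ 1`, `ϖ ≠ 0`). [folklore] -/
theorem zpowDiagGL_conj_mem_proUnipotentGL (hc : ∀ i j, c i = c j) {ϖ : F} (hϖ0 : ϖ ≠ 0)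
    (hϖ1 : valuation F ϖ ≤ 1) {x : GL (Fin n) F} (hx : x ∈ proUnipotentGL n F c) (e : Fin n → ℤ)
    (he : ∀ i j, (x : Matrix (Fin n) (Fin n) F) i j ≠ 0 → e j ≤ e i) :
    zpowDiagGL hϖ0 e * x * (zpowDiagGL hϖ0 e)⁻¹ ∈ proUnipotentGL n F c := by
  rw [← zpowDiagGL_neg]
  set N : GL (Fin n) F := zpowDiagGL hϖ0 e * x * zpowDiagGL hϖ0 (-e) with hN
  have hxK := (mem_proUnipotentGL_iff_of_const hc x).1 hx
  -- entries of the conjugate are dominated by the entries of `x`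
  have key : ∀ i j, (N : Matrix (Fin n) (Fin n) F) i j =
      (x : Matrix (Fin n) (Fin n) F) i j * ϖ ^ (e i - e j) := fun i j =>
    zpowDiagGL_mul_mul_zpowDiagGL_neg_apply hϖ0 e x i j
  have hval : ∀ i j, valuation F ((N : Matrix (Fin n) (Fin n) F) i j) ≤
      valuation F ((x : Matrix (Fin n) (Fin n) F) i j) := by
    intro i j
    rw [key]
    by_cases h0 : (x : Matrix (Fin n) (Fin n) F) i j = 0
    · rw [h0, zero_mul]
    · have hle : 0 ≤ e i - e j := sub_nonneg.mpr (he i j h0)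
      obtain ⟨d, hd⟩ := Int.eq_ofNat_of_zero_le hle
      rw [hd, zpow_natCast, map_mul, map_pow]
      exact mul_le_of_le_one_right' (pow_le_one' hϖ1 _)
  have hdiag : ∀ i, (N : Matrix (Fin n) (Fin n) F) i i = (x : Matrix (Fin n) (Fin n) F) i i := by
    intro i
    rw [key, sub_self, zpow_zero, mul_one]
  rw [mem_proUnipotentGL_iff_of_const hc]
  refine ⟨mem_glInt_of_isIntegralMatrix (fun i j => ?_) ?_, fun i j => ?_⟩
  · exact (Valuation.mem_integer_iff _ _).2
      ((hval i j).trans (valuation_apply_le_one_of_mem_glInt hxK.1 i j))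
  · rw [hN, Units.val_mul, Units.val_mul, zpowDiagGL_neg, Matrix.det_units_conj]
    exact valuation_det_eq_one_of_mem_glInt hxK.1
  · by_cases hij : i = j
    · subst hij
      rw [hdiag]
      exact hxK.2 i i
    · rw [if_neg hij, sub_zero]
      exact (hval i j).trans_lt (valuation_apply_lt_one_of_mem_proUnipotentGL hc hx hij)

/-- **`ϖ^a K₁ ϖ^b ⊆ K₁ ϖ^a ϖ^b K₁` for dominant `a, b`.** For antitone exponent vectors
`a, b ∈ ℤⁿ` (`a_1 ≥ ⋯ ≥ a_n`, the dominant cone of the diagonal torus with respect to the upper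
Borel) and `k ∈ K₁`: writing `k = B L` (`exists_upper_mul_lower_of_mem_proUnipotentGL`),
`ϖ^a k ϖ^b = (ϖ^a B ϖ^{-a}) · ϖ^a ϖ^b · (ϖ^{-b} L ϖ^{b})` with both outer factors in `K₁`
(`zpowDiagGL_conj_mem_proUnipotentGL`: `ϖ^a` shrinks the upper entries of `B`, `ϖ^{-b}` the lower
entries of `L`). Hence `K₁ ϖ^a K₁ ϖ^b K₁ = K₁ ϖ^{a+b} K₁`, the expansion property behind the
multiplicativity of the operators `[K₁ t K₁]`, `t` dominant (Casselman (1995), Lemma 4.1.5).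
[folklore] -/
theorem exists_zpowDiagGL_mul_mul_zpowDiagGL_eq (hc : ∀ i j, c i = c j) {ϖ : F} (hϖ0 : ϖ ≠ 0)
    (hϖ1 : valuation F ϖ ≤ 1) {a b : Fin n → ℤ} (ha : Antitone a) (hb : Antitone b)
    {k : GL (Fin n) F} (hk : k ∈ proUnipotentGL n F c) :
    ∃ k₁ ∈ proUnipotentGL n F c, ∃ k₂ ∈ proUnipotentGL n F c,
      zpowDiagGL hϖ0 a * k * zpowDiagGL hϖ0 b =
        k₁ * (zpowDiagGL hϖ0 a * zpowDiagGL hϖ0 b) * k₂ := by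
  obtain ⟨B, hB, L, hL, hBu, hLl, rfl⟩ := exists_upper_mul_lower_of_mem_proUnipotentGL hc hk
  refine ⟨zpowDiagGL hϖ0 a * B * (zpowDiagGL hϖ0 a)⁻¹, ?_,
    (zpowDiagGL hϖ0 b)⁻¹ * L * zpowDiagGL hϖ0 b, ?_, by group⟩
  · refine zpowDiagGL_conj_mem_proUnipotentGL hc hϖ0 hϖ1 hB a fun i j hij => ha ?_
    exact not_lt.mp fun h => hij (hBu h)
  · have h := zpowDiagGL_conj_mem_proUnipotentGL hc hϖ0 hϖ1 hL (-b) fun i j hij => by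
      have hji : j ≤ i := not_lt.mp fun h => hij (hLl (OrderDual.toDual_lt_toDual.2 h))
      exact neg_le_neg (hb hji)
    rwa [zpowDiagGL_neg, inv_inv] at h

end Literature.NumberTheory.Automorphic
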